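import Summits.HodgeConjecture.HodgeConjecture.Theorems.TropicalWeilObstructionTropicalWeilVanishingIntegralityLattice
import Summits.HodgeConjecture.HodgeConjecture.Theorems.TropicalWeilObstructionTropicalWeilVanishingBoundaryCalibrated
import Summits.HodgeConjecture.HodgeConjecture.Theorems.TropicalWeilObstructionTropicalWeilVanishingGenericSpread
import Summits.HodgeConjecture.HodgeConjecture.Theorems.TropicalWeilObstructionGenericWeilPeriod
import Literature.GroupTheory.ArithmeticGroups.PositiveDefiniteConeProperAction
import HarnessLib

/-!
# Route `TropicalWeilObstruction` (Kontsevich's tropical test — NEGATION SINK, exploration, no summit claim):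
# the VARIATIONAL direction bound — I. the class of an effective cycle is constant along its realisation family

Negation-sink bookkeeping of the cell `pub-hodge-tropical` (seat tropical-1 gen 9); part I of the VARIATIONAL series
(`…VariationalFamily`, `…VariationalSpan`, `…VariationalDirectionBound`). The open crux K1 (`TropicalWeilVanishing`,
stmt-HodgeConjecture-18478) says that every effective tropical `4`-cycle `Z` on a very general tropical Weil eightfold `ℝ⁸/Qℤ⁸` has
`W(Z) = 0`. The landed necessary conditions on a counterexample (and on the SEEDS of the decision criterion p330167) are of two
kinds: class-level (calibration cone p332805, class positivity κ = 8 p337681/p343407, integrality p345511/p345948) and the one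
size condition of row (F) of the cell's `K1-SCOPE.md` (frame span `≥ 69`, p340981/p341426), obtained from the RANK of the single
class `cyc Z`. This series adds a mechanism of a different kind: it uses the VARIATION OF THE PERIOD INSIDE THE COMBINATORIAL
TYPE. The type of `Z` realises along every line `Q + tD` of the tropical Weil family `Sym_J` (`genericSpread`: p313252's
linear realisation system is defined over `ℚ` and `Q` is very general); this file proves that along such a family the INTEGER
class coordinates of K3 (p322554, p345948) do not move:

* `eventually_posDef_add_smul`, `isWeilGeneric_add_smul` — `Q + tD` is again a positive definite, very general Weil period for
  small rational `t` (openness of the positive cone, `Literature.GroupTheory.ArithmeticGroups`; rational affine substitutions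
  preserve algebraic independence, `GenericWeilPeriod.algebraicIndependent_affine`);
* `exists_lineFamily` — AFFINE real data `V₀ + tV₁`, `T_σ + tT₁σ`, `R₀ + tR₁` realising the type of `Z` over `Q + tD` for every
  real `t` (two members of the `genericSpread` family and the affine structure of the realisation system);
* `sum_frameSquares_lineFamily_eq` — **constancy**: for every rational `t` near `0` the cycle `Z_t` of the family is effective and
  `cyc Z_t = Σ_σ w_σ det(T_σ + tT₁σ)/4! · p_σ ⊗ p_σ = a θ₄(Q + tD) + b Re w(Q + tD) + c Im w(Q + tD)` with the SAME integers
  `(a, b, c)` as `Z` (the coordinates are integers at every very general period and depend continuously on `t` through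
  `μ(Z_t) = a_t det(P(Q+tD)Pᴴ)` and `W(Z_t) = 8 det(P(Q+tD)Pᴴ)(b_t - i c_t)` — `Boundary.mass_eq_of_repr`,
  `Boundary.weilFunctional_eq_of_repr` — hence are locally constant).

Part II extracts from this the polynomial identity `a θ₄(D) + b Re w(D) + c Im w(D) ∈ span_ℝ{p_σ ⊗ p_σ}` for EVERY integer
direction `D ∈ Sym_J(ℤ)`; part III turns it into the direction count (numerically `≥ 626` distinct `4`-planes, against row (F)'s
`69`). HONEST STATUS. A necessary condition on counterexamples/seeds of an OPEN statement; it decides nothing about K1 and nothing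
about the Hodge conjecture, in either direction. No definition, no named fact, no sorry.

References: [Zharkov2020TropicalWeil] I. Zharkov, arXiv:2002.02347, §2 (pp. 2–4); [MikhalkinZharkov2014Eigenwave] G. Mikhalkin,
I. Zharkov, LN UMI 15 (2014), Def. 4.2, Prop. 4.3, Thm. 5.4.
-/

set_option linter.dupNamespace false

noncomputable section

open scoped BigOperators Topology
open Matrix Filter
open Literature.AlgebraicGeometry.Tropical
open Summit.HodgeConjecture.HodgeConjecture.Theorems.TropicalHodgeBound

namespace Summit.HodgeConjecture.HodgeConjecture.Theorems.TropicalWeilVanishing.Variational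

/-! ## §0 Display-only notation (the K3 skeleton's local definitions, verbatim bodies; nothing is defined) -/

/-- `P = [1 | i·1]`, the `n × 2n` matrix of `dz₁ ∧ … ∧ dz_n`. -/
local notation3 (prettyPrint := false) "𝐏⟦" n "⟧" =>
  (Matrix.of fun (k : Fin n) (a : Fin (2 * n)) =>
    (if (a : ℕ) = (k : ℕ) then (1 : ℂ) else 0) + (if (a : ℕ) = (k : ℕ) + n then Complex.I else 0))

/-- The skeleton's `thetaClass n Q`. -/
local notation3 (prettyPrint := false) "θ⟦" n "⟧" Q:max =>
  (fun S S' : Fin n → Fin (2 * n) => Matrix.det (Matrix.submatrix Q S S'))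

/-- The skeleton's `omegaFrame n` (`Ω = Pᴴ`). -/
local notation3 (prettyPrint := false) "Ω⟦" n "⟧" =>
  (Matrix.of fun (a : Fin (2 * n)) (b : Fin n) =>
    (if (a : ℕ) = (b : ℕ) then (1 : ℂ) else 0) - (if (a : ℕ) = (b : ℕ) + n then Complex.I else 0))

/-- The skeleton's `weilClassC n Q` (`w(Q) = (⋀ⁿQ ⊗ 1)(Ω ⊗ Ω)`). -/
local notation3 (prettyPrint := false) "wC⟦" n "⟧" Q:max =>
  (fun S S' : Fin n → Fin (2 * n) =>
    Matrix.det (Matrix.submatrix (Matrix.map Q ((↑) : ℝ → ℂ) * Ω⟦n⟧) S id) *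
      Matrix.det (Matrix.submatrix (Ω⟦n⟧) S' id))

/-- The skeleton's `weilClassRe n Q` (`w₁ = Re w`). -/
local notation3 (prettyPrint := false) "wRe⟦" n "⟧" Q:max =>
  (fun S S' : Fin n → Fin (2 * n) => Complex.re ((wC⟦n⟧ Q) S S'))

/-- The skeleton's `weilClassIm n Q` (`w₂ = Im w`). -/
local notation3 (prettyPrint := false) "wIm⟦" n "⟧" Q:max =>
  (fun S S' : Fin n → Fin (2 * n) => Complex.im ((wC⟦n⟧ Q) S S'))

/-- The hermitian MASS `μ(Z) = Σ_σ w_σ a_σ |η_σ|²` of an effective tropical `n`-cycle. Nothing is defined. -/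
local notation3 (prettyPrint := false) "μ⟦" n "," Z "⟧" =>
  (∑ σ, ((TropicalTorusCycle.cell Z σ).weight : ℝ) * (TropicalTorusCycle.cell Z σ).latticeVolume *
    ‖frameComplexDet n (TropicalTorusCycle.cell Z σ).frame‖ ^ 2)

/-! ## §1 Small tools -/

/-- Positive definiteness is an open condition along a line of symmetric matrices: `Q ≻ 0` and `D` symmetric give
`Q + tD ≻ 0` for all real `t` near `0`. [folklore] -/
theorem eventually_posDef_add_smul {m : ℕ} {Q D : Matrix (Fin m) (Fin m) ℝ} (hQ : Q.PosDef) (hD : D.IsSymm) :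
    ∀ᶠ t : ℝ in 𝓝 0, (Q + t • D).PosDef := by
  have hopen := Literature.GroupTheory.ArithmeticGroups.isOpen_setOf_dotProduct_mulVec_pos (ι := Fin m)
  have hQmem : Q ∈ {S : Matrix (Fin m) (Fin m) ℝ | ∀ v : Fin m → ℝ, v ≠ 0 → 0 < v ⬝ᵥ S *ᵥ v} := by
    intro v hv
    simpa using hQ.dotProduct_mulVec_pos hv
  have hcont : Continuous fun t : ℝ => Q + t • D := continuous_const.add (continuous_id.smul continuous_const)
  have hev : ∀ᶠ t : ℝ in 𝓝 0, Q + t • D ∈ {S : Matrix (Fin m) (Fin m) ℝ | ∀ v : Fin m → ℝ, v ≠ 0 → 0 < v ⬝ᵥ S *ᵥ v} := by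
    apply hcont.continuousAt.eventually_mem
    apply hopen.mem_nhds
    simpa using hQmem
  filter_upwards [hev] with t ht
  have hQS : Q.IsSymm := by
    have h := hQ.1
    rw [Matrix.IsHermitian, Matrix.conjTranspose_eq_transpose_of_trivial] at h
    exact h
  refine Matrix.PosDef.of_dotProduct_mulVec_pos ?_ ?_
  · rw [Matrix.IsHermitian, Matrix.conjTranspose_eq_transpose_of_trivial, Matrix.transpose_add, Matrix.transpose_smul,
      hQS, hD]
  · intro x hx
    simpa using ht x hx

/-- Rational translates of a very general Weil period along an integer direction are very general:
`IsWeilGeneric 4 Q ⟹ IsWeilGeneric 4 (Q + t·D)` for `t ∈ ℚ` and an integer matrix `D`. [folklore] -/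
theorem isWeilGeneric_add_smul {Q : Matrix (Fin (2 * 4)) (Fin (2 * 4)) ℝ} (hgen : IsWeilGeneric 4 Q)
    (D : Matrix (Fin (2 * 4)) (Fin (2 * 4)) ℤ) (t : ℚ) :
    IsWeilGeneric 4 (Q + (t : ℝ) • D.map ((↑) : ℤ → ℝ)) := by
  unfold IsWeilGeneric at hgen ⊢
  have h := GenericWeilPeriod.algebraicIndependent_affine hgen (fun _ => 1)
    (fun ab => t * (D ab.1.1 ab.1.2 : ℚ)) (fun _ => one_ne_zero)
  convert h using 1
  funext ab
  simp only [Matrix.add_apply, Matrix.smul_apply, Matrix.map_apply, smul_eq_mul]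
  push_cast
  ring

/-- Two integers at real distance `< 1` are equal. [folklore] -/
theorem int_eq_of_abs_sub_lt_one {a b : ℤ} (h : |(a : ℝ) - (b : ℝ)| < 1) : a = b := by
  have h' : |a - b| < 1 := by exact_mod_cast h
  have := Int.abs_lt_one_iff.mp h'
  omega

/-! ## §2 The realisation family of an effective cycle along a line of periods -/

variable (Q : Matrix (Fin (2 * 4)) (Fin (2 * 4)) ℝ)

/-- **Line family.** For an effective tropical `4`-cycle `Z` over a very general Weil period `Q` and every symmetric
`J`-commuting direction `D`, there are AFFINE families of real data `V₀ + t V₁` (vertices), `T_σ + t T₁σ` (edge matrices,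
`T_σ` those of `Z`), `R₀ + t R₁` (reference facets) satisfying the edge equations and the facet identifications of the
combinatorial type of `Z` over the period `Q + t D`, for EVERY real `t` (genericSpread at `Q` and at `Q + D`, then the
affine combination). [cite: Zharkov2020TropicalWeil, §2 (p. 3)] [cite: MikhalkinZharkov2014Eigenwave, Def. 4.2] -/
theorem exists_lineFamily (hQ : Q.PosDef) (hJ : Q * weilJ 4 = weilJ 4 * Q) (hgen : IsWeilGeneric 4 Q)
    (Z : TropicalTorusCycle (2 * 4) 4 Q) (D : Matrix (Fin (2 * 4)) (Fin (2 * 4)) ℝ) (hDS : D.IsSymm)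
    (hDJ : D * weilJ 4 = weilJ 4 * D) :
    ∃ (V₀ V₁ : Fin Z.numCells → Fin (4 + 1) → Fin (2 * 4) → ℝ) (T₁ : Fin Z.numCells → Matrix (Fin 4) (Fin 4) ℝ)
      (R₀ R₁ : Fin Z.numFacetClasses → Fin 4 → Fin (2 * 4) → ℝ),
      ∀ t : ℝ,
        (∀ (σ : Fin Z.numCells) (j : Fin 4) (a : Fin (2 * 4)),
            (V₀ σ j.succ a + t * V₁ σ j.succ a) - (V₀ σ 0 a + t * V₁ σ 0 a) =
              ∑ m, ((Z.cell σ).frame a m : ℝ) * ((Z.cell σ).edgeCoeff + t • T₁ σ) m j) ∧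
        (∀ (σ : Fin Z.numCells) (i : Fin (4 + 1)) (j : Fin 4) (a : Fin (2 * 4)),
            V₀ σ (i.succAbove (Z.facetPerm σ i j)) a + t * V₁ σ (i.succAbove (Z.facetPerm σ i j)) a =
              (R₀ (Z.facetClass σ i) j a + t * R₁ (Z.facetClass σ i) j a) +
                ∑ b, (Q + t • D) a b * (Z.facetShift σ i b : ℝ)) := by
  obtain ⟨V, T, Rf, -, hTQ, hreal⟩ := genericSpread hQ hJ hgen Z
  have hQS : Q.IsSymm := by
    have h := hQ.1
    rw [Matrix.IsHermitian, Matrix.conjTranspose_eq_transpose_of_trivial] at h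
    exact h
  have hQ1S : (Q + D).IsSymm := hQS.add hDS
  have hQ1J : (Q + D) * weilJ 4 = weilJ 4 * (Q + D) := by rw [Matrix.add_mul, Matrix.mul_add, hJ, hDJ]
  obtain ⟨hv0, hf0⟩ := hreal Q hQS hJ
  obtain ⟨hv1, hf1⟩ := hreal (Q + D) hQ1S hQ1J
  refine ⟨V Q, fun σ j a => V (Q + D) σ j a - V Q σ j a, fun σ => T (Q + D) σ - T Q σ, Rf Q,
    fun f j a => Rf (Q + D) f j a - Rf Q f j a, fun t => ⟨?_, ?_⟩⟩
  · intro σ j a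
    dsimp only
    have e0 := hv0 σ j a
    have e1 := hv1 σ j a
    rw [hTQ σ] at e0
    have : ∑ m, ((Z.cell σ).frame a m : ℝ) * ((Z.cell σ).edgeCoeff + t • (T (Q + D) σ - T Q σ)) m j =
        ∑ m, ((Z.cell σ).frame a m : ℝ) * (Z.cell σ).edgeCoeff m j +
          t * (∑ m, ((Z.cell σ).frame a m : ℝ) * T (Q + D) σ m j -
            ∑ m, ((Z.cell σ).frame a m : ℝ) * (Z.cell σ).edgeCoeff m j) := by
      rw [hTQ σ, mul_sub, Finset.mul_sum, Finset.mul_sum, ← Finset.sum_sub_distrib, ← Finset.sum_add_distrib]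
      refine Finset.sum_congr rfl fun m _ => ?_
      simp only [Matrix.add_apply, Matrix.smul_apply, Matrix.sub_apply, smul_eq_mul]
      ring
    rw [this, ← e0, ← e1]
    ring
  · intro σ i j a
    dsimp only
    have e0 := hf0 σ i j a
    have e1 := hf1 σ i j a
    have : ∑ b, (Q + t • D) a b * (Z.facetShift σ i b : ℝ) =
        ∑ b, Q a b * (Z.facetShift σ i b : ℝ) +
          t * (∑ b, (Q + D) a b * (Z.facetShift σ i b : ℝ) - ∑ b, Q a b * (Z.facetShift σ i b : ℝ)) := by
      rw [mul_sub, Finset.mul_sum, Finset.mul_sum, ← Finset.sum_sub_distrib, ← Finset.sum_add_distrib]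
      refine Finset.sum_congr rfl fun b _ => ?_
      simp only [Matrix.add_apply, Matrix.smul_apply, smul_eq_mul]
      ring
    rw [this, e0, e1]
    ring

/-! ## §3 The integer class is CONSTANT along the family -/

/-- **Constancy of the class along the realisation family.** Let `Z` be an effective tropical `4`-cycle over a very
general Weil period `Q` with (integer, p345948) class coordinates `cyc Z = a θ₄(Q) + b Re w(Q) + c Im w(Q)`, and let `D` be an
integer symmetric `J`-commuting direction with a line family as in `exists_lineFamily`. Then for every RATIONAL parameter `t`
near `0` the cycle `Z_t` of the family over `Q + tD` is effective and has THE SAME coordinates: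
`cyc Z_t = a θ₄(Q + tD) + b Re w(Q + tD) + c Im w(Q + tD)` (`Q + tD` is again positive definite and very general, so K3's
coordinates exist and are integers there; they depend continuously on `t` through `μ(Z_t) = q₀ det(P(Q+tD)Pᴴ)` and
`W(Z_t) = 8 det(P(Q+tD)Pᴴ)(q₁ - iq₂)`, hence are locally constant).
[cite: Zharkov2020TropicalWeil, §2 (pp. 2–4)] [cite: MikhalkinZharkov2014Eigenwave, Prop. 4.3 and Thm. 5.4] -/
theorem sum_frameSquares_lineFamily_eq (hQ : Q.PosDef) (hJ : Q * weilJ 4 = weilJ 4 * Q) (hgen : IsWeilGeneric 4 Q)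
    (Z : TropicalTorusCycle (2 * 4) 4 Q) {a b c : ℤ}
    (hq : Z.cyc = (a : ℝ) • θ⟦4⟧ Q + (b : ℝ) • wRe⟦4⟧ Q + (c : ℝ) • wIm⟦4⟧ Q)
    (D : Matrix (Fin (2 * 4)) (Fin (2 * 4)) ℤ) (hDS : (D.map ((↑) : ℤ → ℝ)).IsSymm)
    (hDJr : D.map ((↑) : ℤ → ℝ) * weilJ 4 = weilJ 4 * D.map ((↑) : ℤ → ℝ))
    (V₀ V₁ : Fin Z.numCells → Fin (4 + 1) → Fin (2 * 4) → ℝ) (T₁ : Fin Z.numCells → Matrix (Fin 4) (Fin 4) ℝ)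
    (R₀ R₁ : Fin Z.numFacetClasses → Fin 4 → Fin (2 * 4) → ℝ)
    (hfam : ∀ t : ℝ,
        (∀ (σ : Fin Z.numCells) (j : Fin 4) (a : Fin (2 * 4)),
            (V₀ σ j.succ a + t * V₁ σ j.succ a) - (V₀ σ 0 a + t * V₁ σ 0 a) =
              ∑ m, ((Z.cell σ).frame a m : ℝ) * ((Z.cell σ).edgeCoeff + t • T₁ σ) m j) ∧
        (∀ (σ : Fin Z.numCells) (i : Fin (4 + 1)) (j : Fin 4) (a : Fin (2 * 4)),
            V₀ σ (i.succAbove (Z.facetPerm σ i j)) a + t * V₁ σ (i.succAbove (Z.facetPerm σ i j)) a =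
              (R₀ (Z.facetClass σ i) j a + t * R₁ (Z.facetClass σ i) j a) +
                ∑ b, (Q + t • D.map ((↑) : ℤ → ℝ)) a b * (Z.facetShift σ i b : ℝ))) :
    ∃ S ∈ 𝓝 (0 : ℝ), ∀ t : ℚ, (t : ℝ) ∈ S →
      (∀ σ, 0 < ((Z.cell σ).edgeCoeff + (t : ℝ) • T₁ σ).det) ∧
        (fun S S' : Fin 4 → Fin (2 * 4) => ∑ σ, ((Z.cell σ).weight : ℝ) *
            (((Z.cell σ).edgeCoeff + (t : ℝ) • T₁ σ).det / (Nat.factorial 4 : ℝ)) *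
            ((pluckerCoord (Z.cell σ).frame S : ℤ) : ℝ) * ((pluckerCoord (Z.cell σ).frame S' : ℤ) : ℝ)) =
          (a : ℝ) • θ⟦4⟧ (Q + (t : ℝ) • D.map ((↑) : ℤ → ℝ)) +
            (b : ℝ) • wRe⟦4⟧ (Q + (t : ℝ) • D.map ((↑) : ℤ → ℝ)) +
            (c : ℝ) • wIm⟦4⟧ (Q + (t : ℝ) • D.map ((↑) : ℤ → ℝ)) := by
  set Dr : Matrix (Fin (2 * 4)) (Fin (2 * 4)) ℝ := D.map ((↑) : ℤ → ℝ) with hDr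
  have hDJ' : ∀ (P : Matrix (Fin (2 * 4)) (Fin (2 * 4)) ℝ) (t : ℝ), P = Q + t • Dr →
      (Dr * weilJ 4 = weilJ 4 * Dr) → P * weilJ 4 = weilJ 4 * P := by
    rintro P t rfl hDJ
    rw [Matrix.add_mul, Matrix.mul_add, Matrix.smul_mul, Matrix.mul_smul, hJ, hDJ]
  -- the three scalar functions of `t`: mass, Weil functional, `det(P (Q+tD) Pᴴ)`
  set E : Fin Z.numCells → Matrix (Fin 4) (Fin 4) ℝ := fun σ => (Z.cell σ).edgeCoeff with hE
  set m : ℝ → ℝ := fun t => ∑ σ, ((Z.cell σ).weight : ℝ) * ((E σ + t • T₁ σ).det / (Nat.factorial 4 : ℝ)) *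
    ‖frameComplexDet 4 (Z.cell σ).frame‖ ^ 2 with hm
  set wf : ℝ → ℂ := fun t => ∑ σ, ((Z.cell σ).weight : ℂ) * (((E σ + t • T₁ σ).det / (Nat.factorial 4 : ℝ) : ℝ) : ℂ) *
    frameComplexDet 4 (Z.cell σ).frame ^ 2 with hwf
  set d : ℝ → ℂ := fun t => (𝐏⟦4⟧ * (Q + t • Dr).map ((↑) : ℝ → ℂ) * (𝐏⟦4⟧)ᴴ).det with hd
  -- continuity
  have hcE : ∀ σ, Continuous fun t : ℝ => (E σ + t • T₁ σ).det := fun σ =>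
    (continuous_const.add (continuous_id.smul continuous_const)).matrix_det
  have hcm : Continuous m := by
    refine continuous_finsetSum _ fun σ _ => ?_
    exact (continuous_const.mul ((hcE σ).div_const _)).mul continuous_const
  have hcwf : Continuous wf := by
    refine continuous_finsetSum _ fun σ _ => ?_
    exact (continuous_const.mul (Complex.continuous_ofReal.comp ((hcE σ).div_const _))).mul continuous_const
  have hcd : Continuous d := by
    refine Continuous.matrix_det ?_
    refine (continuous_const.matrix_mul ?_).matrix_mul continuous_const
    exact (Continuous.matrix_map (continuous_const.add (continuous_id.smul continuous_const))
      Complex.continuous_ofReal)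
  have hd0 : d 0 ≠ 0 := by
    have h := (det_frame_mul_map_mul_conjTranspose_pos Q hQ).1
    intro h0
    have : d 0 = (𝐏⟦4⟧ * Q.map ((↑) : ℝ → ℂ) * (𝐏⟦4⟧)ᴴ).det := by simp [hd]
    rw [← this, h0] at h
    simp at h
  -- the eventual conditions
  have E1 : ∀ᶠ t : ℝ in 𝓝 0, ∀ σ, 0 < (E σ + t • T₁ σ).det := by
    refine Filter.eventually_all.2 fun σ => ?_
    have h0 : (0 : ℝ) < (E σ + (0 : ℝ) • T₁ σ).det := by
      simp only [zero_smul, add_zero, hE]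
      exact (Z.cell σ).edgeCoeff_det_pos
    exact ((hcE σ).tendsto 0).eventually_const_lt h0
  have E2 : ∀ᶠ t : ℝ in 𝓝 0, (Q + t • Dr).PosDef := eventually_posDef_add_smul hQ hDS
  have E3 : ∀ᶠ t : ℝ in 𝓝 0, dist ((m t : ℂ) / d t) ((m 0 : ℂ) / d 0) < 1 :=
    Metric.tendsto_nhds.1 (((Complex.continuous_ofReal.comp hcm).continuousAt.div hcd.continuousAt hd0)) 1 one_pos
  have E4 : ∀ᶠ t : ℝ in 𝓝 0, dist (wf t / (8 * d t)) (wf 0 / (8 * d 0)) < 1 :=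
    Metric.tendsto_nhds.1 ((hcwf.continuousAt.div (continuous_const.mul hcd).continuousAt
      (mul_ne_zero (by norm_num) hd0))) 1 one_pos
  refine ⟨{t | (∀ σ, 0 < (E σ + t • T₁ σ).det) ∧ (Q + t • Dr).PosDef ∧
      dist ((m t : ℂ) / d t) ((m 0 : ℂ) / d 0) < 1 ∧ dist (wf t / (8 * d t)) (wf 0 / (8 * d 0)) < 1},
    (E1.and (E2.and (E3.and E4))), ?_⟩
  intro t ht
  obtain ⟨hdet, hPD, hg, hh⟩ := ht
  refine ⟨hdet, ?_⟩
  -- the cycle `Z_t` of the family over `Q + tD`: same cells (weights, frames), same facet data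
  let Zt : TropicalTorusCycle (2 * 4) 4 (Q + (t : ℝ) • Dr) :=
    { numCells := Z.numCells
      cell := fun σ =>
        { weight := (Z.cell σ).weight
          weight_pos := (Z.cell σ).weight_pos
          vertex := fun j a => V₀ σ j a + (t : ℝ) * V₁ σ j a
          frame := (Z.cell σ).frame
          edgeCoeff := (Z.cell σ).edgeCoeff + (t : ℝ) • T₁ σ
          vertex_succ_sub := (hfam t).1 σ
          edgeCoeff_det_pos := hdet σ
          frame_saturated := (Z.cell σ).frame_saturated }
      numFacetClasses := Z.numFacetClasses
      refFacet := fun f j a => R₀ f j a + (t : ℝ) * R₁ f j a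
      facetClass := Z.facetClass
      facetPerm := Z.facetPerm
      facetShift := Z.facetShift
      facet_eq := (hfam t).2
      balanced := Z.balanced }
  have hcycZt : Zt.cyc = fun S S' : Fin 4 → Fin (2 * 4) => ∑ σ, ((Z.cell σ).weight : ℝ) *
      (((Z.cell σ).edgeCoeff + (t : ℝ) • T₁ σ).det / (Nat.factorial 4 : ℝ)) *
      ((pluckerCoord (Z.cell σ).frame S : ℤ) : ℝ) * ((pluckerCoord (Z.cell σ).frame S' : ℤ) : ℝ) := rfl
  rw [← hcycZt]
  -- the period `P = Q + tD`: positive definite, `J`-commuting, very general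
  have hDJ : Dr * weilJ 4 = weilJ 4 * Dr := hDJr
  have hPJ : (Q + (t : ℝ) • Dr) * weilJ 4 = weilJ 4 * (Q + (t : ℝ) • Dr) := hDJ' _ (t : ℝ) rfl hDJ
  have hPgen : IsWeilGeneric 4 (Q + (t : ℝ) • Dr) := isWeilGeneric_add_smul hgen D t
  -- integer coordinates at `P`
  obtain ⟨a₁, b₁, c₁, hqt, -, -⟩ := Integrality.latticePoint_int (Q + (t : ℝ) • Dr) hPD hPJ hPgen Zt
  -- mass and Weil functional of `Z_t` and of `Z` in coordinates
  have hMt := Boundary.mass_eq_of_repr (Q + (t : ℝ) • Dr) hPJ Zt hqt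
  have hWt := Boundary.weilFunctional_eq_of_repr (Q + (t : ℝ) • Dr) hPJ Zt hqt
  have hM0 := Boundary.mass_eq_of_repr Q hJ Z hq
  have hW0 := Boundary.weilFunctional_eq_of_repr Q hJ Z hq
  have hdt' : (𝐏⟦4⟧ * (Q + (t : ℝ) • Dr).map ((↑) : ℝ → ℂ) * (𝐏⟦4⟧)ᴴ).det = d t := rfl
  have hdt : d t ≠ 0 := by
    have h := (det_frame_mul_map_mul_conjTranspose_pos (Q + (t : ℝ) • Dr) hPD).1
    intro h0
    rw [hdt', h0] at h
    simp at h
  -- identify `μ(Z_t) = m t`, `W(Z_t) = wf t`, `μ(Z) = m 0`, `W(Z) = wf 0`, `d 0 = det(P Q Pᴴ)`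
  have hmt : (∑ σ, ((TropicalTorusCycle.cell Zt σ).weight : ℝ) * (TropicalTorusCycle.cell Zt σ).latticeVolume *
      ‖frameComplexDet 4 (TropicalTorusCycle.cell Zt σ).frame‖ ^ 2) = m t := rfl
  have hwt : weilFunctional Zt = wf t := rfl
  have hm0 : (∑ σ, ((TropicalTorusCycle.cell Z σ).weight : ℝ) * (TropicalTorusCycle.cell Z σ).latticeVolume *
      ‖frameComplexDet 4 (TropicalTorusCycle.cell Z σ).frame‖ ^ 2) = m 0 := by
    simp only [hm, TropicalCell.latticeVolume, hE, zero_smul, add_zero]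
  have hw0 : weilFunctional Z = wf 0 := by
    simp only [hwf, weilFunctional, TropicalCell.latticeVolume, hE, zero_smul, add_zero]
  have hd0' : (𝐏⟦4⟧ * Q.map ((↑) : ℝ → ℂ) * (𝐏⟦4⟧)ᴴ).det = d 0 := by simp [hd]
  rw [hmt, hdt'] at hMt
  rw [hwt, hdt'] at hWt
  rw [hm0, hd0'] at hM0
  rw [hw0, hd0'] at hW0
  -- the coordinate functions: `m/d` and `wf/(8d)`
  have hgt : ((m t : ℝ) : ℂ) / d t = (a₁ : ℂ) := by
    rw [hMt]; push_cast; field_simp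
  have hg0 : ((m 0 : ℝ) : ℂ) / d 0 = (a : ℂ) := by
    rw [hM0]; push_cast; field_simp
  have hht : wf t / (8 * d t) = (b₁ : ℂ) - Complex.I * (c₁ : ℂ) := by
    rw [hWt]; push_cast; field_simp
  have hh0 : wf 0 / (8 * d 0) = (b : ℂ) - Complex.I * (c : ℂ) := by
    rw [hW0]; push_cast; field_simp
  rw [hgt, hg0, Complex.dist_eq] at hg
  rw [hht, hh0, Complex.dist_eq] at hh
  -- integers at distance `< 1`
  have ea : a₁ = a := by
    apply int_eq_of_abs_sub_lt_one
    have : ‖((a₁ : ℂ) - (a : ℂ))‖ = |(a₁ : ℝ) - (a : ℝ)| := by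
      rw [← Complex.ofReal_intCast, ← Complex.ofReal_intCast, ← Complex.ofReal_sub, Complex.norm_real,
        Real.norm_eq_abs]
    rw [← this]; exact hg
  have eb : b₁ = b := by
    apply int_eq_of_abs_sub_lt_one
    refine lt_of_le_of_lt ?_ hh
    have : ((b₁ : ℝ) - (b : ℝ)) = ((b₁ : ℂ) - Complex.I * (c₁ : ℂ) - ((b : ℂ) - Complex.I * (c : ℂ))).re := by
      simp
    rw [this]; exact Complex.abs_re_le_norm _
  have ec : c₁ = c := by
    apply int_eq_of_abs_sub_lt_one
    refine lt_of_le_of_lt ?_ hh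
    have : ((c₁ : ℝ) - (c : ℝ)) = -((b₁ : ℂ) - Complex.I * (c₁ : ℂ) - ((b : ℂ) - Complex.I * (c : ℂ))).im := by
      simp; ring
    rw [this, abs_neg]; exact Complex.abs_im_le_norm _
  rw [hqt, ea, eb, ec]


end Summit.HodgeConjecture.HodgeConjecture.Theorems.TropicalWeilVanishing.Variational

end
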